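import Summits.AtomisticToContinuum.Crystallization.Theorems.FrustratedLawDichotomyStrainedPatchHomExteriorAnnulusV2
import Summits.AtomisticToContinuum.Crystallization.Theorems.FrustratedLawDichotomyStrainedPatchHomExteriorColumnV2

/-!
# Strained patch, `(H)` hcp certificate (architecture R3) — the v2 annulus as a semantic leaf and the SIX-KIND column menu `colLeaf6`
# (cell | `entryLeafOKHC` | `exteriorOK` | `annulusOK` | `exteriorOK2` | ★ `annulusOK2`) closed by ONE `decide` (decomp-a2c hand 2, generation 39; structural #20)

`semOKH_of_annulusOK2`, `colLeaf6 L μ₀` (labels `ℕ ⊕ Unit ⊕ ExtLeafData ⊕ AnnLeafData ⊕ ExtLeafData ⊕ AnnLeafData`, the last two read by the v2 verdicts), ★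
`semOKH_root_of_colManifest6` — the most general root consumer of this generation.  0 sorry; standard axioms.  `--supports stmt-AtomisticToContinuum-27623`.
-/

namespace Summit.AtomisticToContinuum.Crystallization.Theorems.FrustratedLawDichotomyStrainedPatchHomExteriorRay

open Summit.AtomisticToContinuum.Crystallization.Theorems.FrustratedLawDichotomyStrainedPatchHomEntryGramHcp (rootCH rootWH)
open Summit.AtomisticToContinuum.Crystallization.Theorems.FrustratedLawDichotomyStrainedPatchHomEntryLeafHT (semOKH semOKH_of_sound semOKH_anti_box)
open Summit.AtomisticToContinuum.Crystallization.Theorems.FrustratedLawDichotomyStrainedPatchHomForceCentredHcp (entryLeafOKHC)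
open Summit.AtomisticToContinuum.Crystallization.Theorems.FrustratedLawDichotomyStrainedPatchHomCutTree (CutTree cutOK coveredAt coveredAt_sound
  semOKH_of_cutOK_leaves semOKH_of_entryLeafOKHC_level)

/-- ★ **An accepted v2 annulus / signed-floor leaf is a semantic fact at every level.** [formal bookkeeping] -/
theorem semOKH_of_annulusOK2 {J : Fin 3 → Fin 3 × Fin 3 → ℤ} {cC wC cH wH : Bx} {ch : List (Bx × Bx × (Fin 3 → Fin 3 → ℤ) × ℤ)} {ll : List ℤ} {den : ℤ}
    {na nb : List ℤ} {g : ℤ} {i : Fin 3} {c w : Bx} (h : annulusOK2 J cC wC cH wH ch ll den na nb g i c w = true) (μ : ℤ) : semOKH μ c w = true :=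
  semOKH_of_sound (μ := μ) (fun c w => annulusOK2 J cC wC cH wH ch ll den na nb g i c w)
    (fun _ _ hv U ξ hsa hU hbox hξ h0 h2 => annulusOK2_sound hv U ξ hsa hU hbox hξ h0 h2) h

/-- **THE SIX-KIND COLUMN LEAF MENU** (v1 and v2 exterior/annulus leaves side by side). Computable. -/
def colLeaf6 (L : List (Bx × Bx)) (μ₀ : ℤ) : ℕ ⊕ (Unit ⊕ (ExtLeafData ⊕ (AnnLeafData ⊕ (ExtLeafData ⊕ AnnLeafData)))) → Bx → Bx → Bool
  | .inl i, c, w => coveredAt L i c w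
  | .inr (.inl _), c, w => entryLeafOKHC μ₀ c w
  | .inr (.inr (.inl e)), c, w => exteriorOK e.J e.cC e.wC e.cH e.wH e.ch e.lmin e.g e.i c w
  | .inr (.inr (.inr (.inl a))), c, w => annulusOK a.J a.cC a.wC a.cH a.wH a.ch a.ll a.den a.na a.nb a.g a.i c w
  | .inr (.inr (.inr (.inr (.inl e)))), c, w => exteriorOK2 e.J e.cC e.wC e.cH e.wH e.ch e.lmin e.g e.i c w
  | .inr (.inr (.inr (.inr (.inr a)))), c, w => annulusOK2 a.J a.cC a.wC a.cH a.wH a.ch a.ll a.den a.na a.nb a.g a.i c w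

/-- ★★ **THE SIX-KIND MENU FOLD.** [formal bookkeeping] -/
theorem semOKH_of_cutOK_colLeaf6 {μ μ₀ : ℤ} (hle : μ ≤ μ₀) (L : List (Bx × Bx)) (hL : ∀ b ∈ L, semOKH μ b.1 b.2 = true) :
    ∀ (t : CutTree ((Fin 3 × Fin 3) ⊕ Fin 3) (ℕ ⊕ (Unit ⊕ (ExtLeafData ⊕ (AnnLeafData ⊕ (ExtLeafData ⊕ AnnLeafData)))))) (c w : Bx),
      cutOK (colLeaf6 L μ₀) t c w = true → semOKH μ c w = true :=
  semOKH_of_cutOK_leaves (colLeaf6 L μ₀) fun a c w h => by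
    rcases a with i | u | e | a | e | a
    · exact coveredAt_sound (semOKH μ) (fun _ _ _ _ hc h => semOKH_anti_box hc h) L hL i c w h
    · exact semOKH_of_entryLeafOKHC_level hle h
    · exact semOKH_of_exteriorOK h μ
    · exact semOKH_of_annulusOK h μ
    · exact semOKH_of_exteriorOK2 h μ
    · exact semOKH_of_annulusOK2 h μ

/-- ★★★ **THE hcp ROOT FACT FROM A SIX-KIND COLUMN MANIFEST.** [formal bookkeeping] -/
theorem semOKH_root_of_colManifest6 {μ μ₀ : ℤ} (hle : μ ≤ μ₀) (L : List (Bx × Bx)) (hL : ∀ b ∈ L, semOKH μ b.1 b.2 = true)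
    (t : CutTree ((Fin 3 × Fin 3) ⊕ Fin 3) (ℕ ⊕ (Unit ⊕ (ExtLeafData ⊕ (AnnLeafData ⊕ (ExtLeafData ⊕ AnnLeafData))))))
    (h : cutOK (colLeaf6 L μ₀) t rootCH rootWH = true) : semOKH μ rootCH rootWH = true :=
  semOKH_of_cutOK_colLeaf6 hle L hL t rootCH rootWH h

end Summit.AtomisticToContinuum.Crystallization.Theorems.FrustratedLawDichotomyStrainedPatchHomExteriorRay
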